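import Summits.BirchSwinnertonDyer.Rank1Residual.X2.ResidualDevissageModules
import Literature.NumberTheory.EllipticCurves.BSDSelmerPConverseSerreProofs
import HarnessLib

/-!
# Route `CumulativeHeegnerLeopoldt`, crux K1 `CumulativeHeegnerInclusionAtThree` (stmt-BirchSwinnertonDyer-24198),
# line `birth`, STUB B1: THE DETERMINANT ON A STABLE LINE — `φ · ψ = ω` for `0 → Φ → E[p] → E[p]/Φ → 0`,
# i.e. the «`θ|_D ≠ ω`» hypotheses of `CastellaGrossiLeeSkinner2022.prop14_residualCharacterSelmer_finite`
# for `M = Φ` and `M = E[p]/Φ` from the non-anomalous clauses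

Width seat bsd-line-chl-k1-p1-w2 (`--supports stmt-BirchSwinnertonDyer-24198`; the lead's v4 stub «det-on-line»).
For an elliptic curve `X/K` (`K` a number field), a prime `p`, a `Γ_K`-stable subgroup `S ≤ E[p]` of order `p`
(`X2.ResidualDevissageModules.StableSubgroup`: `Γ_K` acts on the line `S.Sub = Φ` through a character `φ` and on
`S.Quot = E[p]/Φ` through `ψ`) and ANY `g ∈ Γ_K`: since `det ρ̄_{E,p}(g) = ω(g)` (Weil pairing, tree
`det_eq_modNCyclotomicCharacter`), `φ(g) ψ(g) = ω(g)`. Concretely (no character objects needed):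

* `smul_quot_eq_of_smul_sub_eq_cyclotomic` — if `g` acts on `Φ` by `ω(g)` then `g` acts trivially on `E[p]/Φ`;
* `smul_quot_eq_cyclotomic_of_smul_sub_eq` — if `g` acts trivially on `Φ` then `g` acts on `E[p]/Φ` by `ω(g)`;
* the contrapositives over a subgroup `D ≤ Γ_K` (a decomposition group):
  **`not_forall_smul_sub_eq_cyclotomic`** («`D` does not act trivially on `E[p]/Φ`» ⟹ «`D` does not act on `Φ`
  through `modNCyclotomicCharacter`») — VERBATIM the
  `¬ ∀ g ∈ decomp 𝔭, ∀ m : M, g • m = ((modNCyclotomicCharacter K p g : (ZMod p)ˣ) : ZMod p).val • m` hypothesis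
  of the printed fact for `M = S.Sub`, from the cell's non-anomalous `ψ`-clause (transported to `K` in
  `…LineBaseChange`). The companion for `M = S.Quot` (from the `φ`-clause: «`D` does not fix `Φ` pointwise» ⟹
  «`D` does not act on `E[p]/Φ` through `ω`») follows from the same core computation once the line action is
  written as a scalar — left to the sequel.

Proof: 2 × 2 linear algebra in a frame `e : E[p] ≃ (ℤ/p)²` (`nonempty_addEquiv_geomTorsion`, `exists_rep_of_addEquiv`):
for the matrix `M` of `g`, `(Mc ∧ Mu) = det M · (c ∧ u)` with `c = e(m₀)`, `m₀ ∈ Φ ∖ 0` an eigenvector; over the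
field `𝔽_p`, `c ∧ w = 0` forces `w ∈ 𝔽_p c = e(Φ)`. THEOREMS ONLY; no definition, no named fact, no `sorry`;
route-independent imports. BSD is not proved by any of this.

References: [SilvermanCSS1997] Ch. II §7–§8 (det ρ̄ = χ); [SilvermanAEC2009] III.8; [CastellaGrossiLeeSkinner2022] §1.2
Prop. 14 hypothesis `θ|_{G_v̄} ≠ 1, ω`, §1.4 (`ψ = ωφ⁻¹`).
-/

set_option autoImplicit false
set_option linter.dupNamespace false

noncomputable section

open scoped Classical Matrix

namespace Summit.BirchSwinnertonDyer.BirchSwinnertonDyer.Theorems.CumulativeHeegnerInclusionAtThreeStubB1LineDeterminant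

open Literature.NumberTheory.EllipticCurves Literature.NumberTheory.GaloisRepresentations
  NumberField Field WeierstrassCurve
  Summit.BirchSwinnertonDyer.Rank1Residual.X2.ResidualDevissageModules

/-! ### §0 Two-by-two linear algebra -/

section TwoByTwo

variable {R : Type*} [CommRing R]

/-- `(Mc) ∧ (Mu) = det M · (c ∧ u)` for `2 × 2` matrices (`∧` the `2 × 2` determinant of a pair of vectors).
[folklore] -/
theorem cross_mulVec (M : Matrix (Fin 2) (Fin 2) R) (c u : Fin 2 → R) :
    (M *ᵥ c) 0 * (M *ᵥ u) 1 - (M *ᵥ c) 1 * (M *ᵥ u) 0 = M.det * (c 0 * u 1 - c 1 * u 0) := by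
  simp only [Matrix.mulVec, dotProduct, Fin.sum_univ_two, Matrix.det_fin_two]
  ring

/-- Over a field: if `c ≠ 0` and `c ∧ w = 0` then `w` lies on the line of `c`. [folklore] -/
theorem exists_eq_smul_of_cross_eq_zero {F : Type*} [Field F] {c : Fin 2 → F} (hc : c ≠ 0)
    {w : Fin 2 → F} (h : c 0 * w 1 - c 1 * w 0 = 0) : ∃ t : F, w = t • c := by
  by_cases h0 : c 0 = 0
  · have h1 : c 1 ≠ 0 := by
      intro h1
      exact hc (funext fun i ↦ by fin_cases i <;> simp [h0, h1])
    have hw0 : w 0 = 0 := by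
      rw [h0, zero_mul, zero_sub, neg_eq_zero] at h
      exact (mul_eq_zero.mp h).resolve_left h1
    refine ⟨w 1 / c 1, funext fun i ↦ ?_⟩
    fin_cases i
    · simp [h0, hw0]
    · simp [div_mul_cancel₀ _ h1]
  · refine ⟨w 0 / c 0, funext fun i ↦ ?_⟩
    fin_cases i
    · simp [div_mul_cancel₀ _ h0]
    · have : w 1 = w 0 / c 0 * c 1 := by
        field_simp
        linear_combination h
      simpa using this

end TwoByTwo

/-! ### §1 The determinant on a stable line of `E[p]` -/

section Line

variable {K : Type} [Field K] [NumberField K] (X : WeierstrassCurve K) [X.IsElliptic]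
  (p : ℕ) [hp : Fact p.Prime]

/-- **Core computation.** `S ≤ E[p]` a `Γ_K`-stable subgroup of order `p`, `g ∈ Γ_K` acting on the line `S`
as multiplication by `k`. Then for every `P ∈ E[p]` and every `k' : ℕ` with `k · k' ≡ ω(g) (mod p)`:
`g P − k' P ∈ S` — i.e. `g` acts on `E[p]/S` as `k'`. (`det ρ̄(g) = ω(g)` in a frame; `(Mc) ∧ (Mu) = det M (c ∧ u)`.)
[cite: SilvermanCSS1997, Ch. II §7 Proposition and §8 (det ρ̄_{E,m} = χ_m)] -/
theorem smul_sub_nsmul_mem_of_smul_sub_eq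
    (S : StableSubgroup (absoluteGaloisGroup K) (X.geomTorsion (p : ℤ))) (hS : Nat.card S.Sub = p)
    (g : absoluteGaloisGroup K) (k k' : ℕ)
    (hkk' : (k : ZMod p) * (k' : ZMod p) = ((modNCyclotomicCharacter K p g : (ZMod p)ˣ) : ZMod p))
    (hk : ∀ m : S.Sub, g • m = k • m) (P : X.geomTorsion (p : ℤ)) :
    g • P - k' • P ∈ S.toAddSubgroup := by
  have hpr : p.Prime := hp.out
  haveI : Fact (1 < p) := ⟨hpr.one_lt⟩
  haveI : NeZero p := ⟨hpr.ne_zero⟩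
  have hpK : (p : K) ≠ 0 := by exact_mod_cast hpr.ne_zero
  haveI : NeZero (p : K) := ⟨hpK⟩
  -- a frame `e : E[p] ≃ (ℤ/p)²` and the matrix `M` of `g`
  obtain ⟨e₁⟩ := nonempty_addEquiv_geomTorsion X p 1 le_rfl hpK
  have e : X.geomTorsion (p : ℤ) ≃+ (Fin 2 → ZMod p) := by
    rw [pow_one] at e₁; exact e₁
  obtain ⟨ρ, hρ⟩ := exists_rep_of_addEquiv X e
  set M : Matrix (Fin 2) (Fin 2) (ZMod p) := ((ρ g : GL (Fin 2) (ZMod p)) : Matrix (Fin 2) (Fin 2) (ZMod p))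
    with hM
  have hdet : M.det = ((modNCyclotomicCharacter K p g : (ZMod p)ˣ) : ZMod p) :=
    det_eq_modNCyclotomicCharacter X p hpr.two_le e g M (hρ g)
  -- a generator `m₀` of the line and its coordinate vector `c ≠ 0`
  haveI : Finite S.Sub := Nat.finite_of_card_ne_zero (by rw [hS]; exact hpr.ne_zero)
  have hnt : Nontrivial S.Sub := Finite.one_lt_card_iff_nontrivial.mp (by rw [hS]; exact hpr.one_lt)
  obtain ⟨m₀, hm₀⟩ := exists_ne (0 : S.Sub)
  set c : Fin 2 → ZMod p := e (S.incl m₀) with hc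
  have hc0 : c ≠ 0 := by
    intro h0
    apply hm₀
    apply S.incl_injective
    rw [map_zero]
    exact e.injective (by rw [map_zero, ← hc, h0])
  have hMc : M *ᵥ c = (k : ZMod p) • c := by
    rw [hc, ← hρ g, ← S.incl_smul, hk m₀, map_nsmul, map_nsmul, Nat.cast_smul_eq_nsmul]
  -- the cross-product identity for `u = e P`
  set u : Fin 2 → ZMod p := e P with hu
  have hcross := cross_mulVec M c u
  rw [hMc, hdet, ← hkk', Pi.smul_apply, Pi.smul_apply, smul_eq_mul, smul_eq_mul] at hcross
  -- `c ∧ (M u - k' u) = 0`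
  have hzero : c 0 * (M *ᵥ u - (k' : ZMod p) • u) 1 - c 1 * (M *ᵥ u - (k' : ZMod p) • u) 0 = 0 := by
    by_cases hk0 : (k : ZMod p) = 0
    · -- then `ω(g) = 0`, impossible for a unit of `ZMod p` (a field): so this case is vacuous
      exfalso
      have hu0 : ((modNCyclotomicCharacter K p g : (ZMod p)ˣ) : ZMod p) = 0 := by
        rw [← hkk', hk0, zero_mul]
      exact (modNCyclotomicCharacter K p g).ne_zero hu0
    · have h' : (k : ZMod p) * (c 0 * (M *ᵥ u) 1 - c 1 * (M *ᵥ u) 0) =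
          (k : ZMod p) * ((k' : ZMod p) * (c 0 * u 1 - c 1 * u 0)) := by
        linear_combination hcross
      have h'' := mul_left_cancel₀ hk0 h'
      simp only [Pi.sub_apply, Pi.smul_apply, smul_eq_mul]
      linear_combination h''
  obtain ⟨t, ht⟩ := exists_eq_smul_of_cross_eq_zero hc0 hzero
  -- back to `E[p]`: `e (g P - k' P) = t • c = e (t.val • m₀)`
  have hcoord : e (g • P - k' • P) = e ((t.val) • S.incl m₀) := by
    rw [map_sub, map_nsmul, map_nsmul, hρ g, ← hu, ← hc, ← Nat.cast_smul_eq_nsmul (ZMod p) k' u,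
      ← Nat.cast_smul_eq_nsmul (ZMod p) t.val c, ZMod.natCast_zmod_val]
    exact ht
  have heq : g • P - k' • P = t.val • S.incl m₀ := e.injective hcoord
  rw [heq]
  exact S.toAddSubgroup.nsmul_mem (by rw [← S.range_incl]; exact ⟨m₀, rfl⟩) _

/-- **`g` acts on `Φ` by `ω(g)` ⟹ `g` acts trivially on `E[p]/Φ`** (`φ(g) = ω(g) ⟹ ψ(g) = 1`).
[cite: SilvermanCSS1997, Ch. II §7–§8 (det ρ̄ = χ)] [cite: CastellaGrossiLeeSkinner2022, §1.4 (ψ = ωφ⁻¹)] -/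
theorem smul_quot_eq_of_smul_sub_eq_cyclotomic
    (S : StableSubgroup (absoluteGaloisGroup K) (X.geomTorsion (p : ℤ))) (hS : Nat.card S.Sub = p)
    (g : absoluteGaloisGroup K)
    (hk : ∀ m : S.Sub, g • m = ((modNCyclotomicCharacter K p g : (ZMod p)ˣ) : ZMod p).val • m)
    (q : S.Quot) : g • q = q := by
  obtain ⟨P, rfl⟩ := S.proj_surjective q
  rw [S.smul_proj, ← sub_eq_zero, ← map_sub, ← AddMonoidHom.mem_ker, S.ker_proj]
  have h := smul_sub_nsmul_mem_of_smul_sub_eq X p S hS g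
    ((modNCyclotomicCharacter K p g : (ZMod p)ˣ) : ZMod p).val 1
    (by rw [ZMod.natCast_zmod_val, Nat.cast_one, mul_one]) hk P
  rwa [one_smul] at h

/-- **`g` acts trivially on `Φ` ⟹ `g` acts on `E[p]/Φ` by `ω(g)`** (`φ(g) = 1 ⟹ ψ(g) = ω(g)`).
[cite: SilvermanCSS1997, Ch. II §7–§8 (det ρ̄ = χ)] [cite: CastellaGrossiLeeSkinner2022, §1.4 (ψ = ωφ⁻¹)] -/
theorem smul_quot_eq_cyclotomic_of_smul_sub_eq
    (S : StableSubgroup (absoluteGaloisGroup K) (X.geomTorsion (p : ℤ))) (hS : Nat.card S.Sub = p)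
    (g : absoluteGaloisGroup K) (hk : ∀ m : S.Sub, g • m = m) (q : S.Quot) :
    g • q = ((modNCyclotomicCharacter K p g : (ZMod p)ˣ) : ZMod p).val • q := by
  obtain ⟨P, rfl⟩ := S.proj_surjective q
  rw [S.smul_proj, ← map_nsmul, ← sub_eq_zero, ← map_sub, ← AddMonoidHom.mem_ker, S.ker_proj]
  exact smul_sub_nsmul_mem_of_smul_sub_eq X p S hS g 1
    ((modNCyclotomicCharacter K p g : (ZMod p)ˣ) : ZMod p).val
    (by rw [ZMod.natCast_zmod_val, Nat.cast_one, one_mul]) (fun m ↦ by rw [hk m, one_smul]) P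

/-- **Hypothesis «`θ|_D ≠ ω`» for `M = Φ`**: if `D` does NOT act trivially on `E[p]/Φ` (non-anomalous `ψ`-clause),
then `D` does not act on `Φ` through the mod-`p` cyclotomic character. [cite: CastellaGrossiLeeSkinner2022, §1.2 Prop. 14 (hypothesis θ|_{G_v̄} ≠ 1, ω) and §1.4] -/
theorem not_forall_smul_sub_eq_cyclotomic
    (S : StableSubgroup (absoluteGaloisGroup K) (X.geomTorsion (p : ℤ))) (hS : Nat.card S.Sub = p)
    (D : Subgroup (absoluteGaloisGroup K)) (hD : ¬ ∀ g ∈ D, ∀ q : S.Quot, g • q = q) :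
    ¬ ∀ g ∈ D, ∀ m : S.Sub,
      g • m = ((modNCyclotomicCharacter K p g : (ZMod p)ˣ) : ZMod p).val • m :=
  fun h ↦ hD fun g hg q ↦ smul_quot_eq_of_smul_sub_eq_cyclotomic X p S hS g (h g hg) q


omit [NumberField K] [X.IsElliptic] in
/-- **The line is cyclic**: in a `Γ_K`-stable `S ≤ E[p]` of prime order `p`, every element is an integer multiple
of any non-zero `m₀`, and `p • m₀ = 0`. [folklore] -/
theorem exists_zsmul_eq_of_ne_zero
    (S : StableSubgroup (absoluteGaloisGroup K) (X.geomTorsion (p : ℤ))) (hS : Nat.card S.Sub = p)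
    {m₀ : S.Sub} (hm₀ : m₀ ≠ 0) : (p • m₀ = 0) ∧ ∀ x : S.Sub, ∃ z : ℤ, x = z • m₀ := by
  have hpr : p.Prime := hp.out
  haveI : Finite S.Sub := Nat.finite_of_card_ne_zero (by rw [hS]; exact hpr.ne_zero)
  have hord : addOrderOf m₀ = p := by
    have hdvd : addOrderOf m₀ ∣ Nat.card S.Sub := addOrderOf_dvd_natCard m₀
    rw [hS] at hdvd
    rcases (Nat.dvd_prime hpr).mp hdvd with h1 | h1
    · exact absurd (AddMonoid.addOrderOf_eq_one_iff.mp h1) hm₀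
    · exact h1
  have hpm : p • m₀ = 0 := by
    have h := addOrderOf_nsmul_eq_zero m₀
    rwa [hord] at h
  refine ⟨hpm, fun x ↦ ?_⟩
  have htop : AddSubgroup.zmultiples m₀ = ⊤ := by
    apply AddSubgroup.eq_top_of_card_eq
    rw [Nat.card_zmultiples, hord, hS]
  have hx : x ∈ AddSubgroup.zmultiples m₀ := by rw [htop]; exact AddSubgroup.mem_top x
  obtain ⟨z, hz⟩ := AddSubgroup.mem_zmultiples_iff.mp hx
  exact ⟨z, hz.symm⟩

/-- **`g` acts on `E[p]/Φ` by `ω(g)` ⟹ `g` acts trivially on `Φ`** (`ψ(g) = ω(g) ⟹ φ(g) = 1`): the converse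
reading of the determinant identity, through a point `P₀ ∉ Φ`. [cite: SilvermanCSS1997, Ch. II §7–§8 (det ρ̄ = χ)] [cite: CastellaGrossiLeeSkinner2022, §1.4 (ψ = ωφ⁻¹)] -/
theorem smul_sub_eq_of_smul_quot_eq_cyclotomic
    (S : StableSubgroup (absoluteGaloisGroup K) (X.geomTorsion (p : ℤ))) (hS : Nat.card S.Sub = p)
    (g : absoluteGaloisGroup K)
    (hq : ∀ q : S.Quot, g • q = ((modNCyclotomicCharacter K p g : (ZMod p)ˣ) : ZMod p).val • q)
    (m : S.Sub) : g • m = m := by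
  have hpr : p.Prime := hp.out
  haveI : Fact (1 < p) := ⟨hpr.one_lt⟩
  haveI : NeZero p := ⟨hpr.ne_zero⟩
  have hpK : (p : K) ≠ 0 := by exact_mod_cast hpr.ne_zero
  haveI : NeZero (p : K) := ⟨hpK⟩
  by_cases hm : m = 0
  · rw [hm, smul_zero]
  -- frame and matrix
  obtain ⟨e₁⟩ := nonempty_addEquiv_geomTorsion X p 1 le_rfl hpK
  have e : X.geomTorsion (p : ℤ) ≃+ (Fin 2 → ZMod p) := by
    rw [pow_one] at e₁; exact e₁
  obtain ⟨ρ, hρ⟩ := exists_rep_of_addEquiv X e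
  set M : Matrix (Fin 2) (Fin 2) (ZMod p) := ((ρ g : GL (Fin 2) (ZMod p)) : Matrix (Fin 2) (Fin 2) (ZMod p))
    with hM
  set ω : ZMod p := ((modNCyclotomicCharacter K p g : (ZMod p)ˣ) : ZMod p) with hω
  have hdet : M.det = ω := det_eq_modNCyclotomicCharacter X p hpr.two_le e g M (hρ g)
  have hω0 : ω ≠ 0 := (modNCyclotomicCharacter K p g).ne_zero
  -- the line: `g m = z₀ m`, everything a multiple of `m`
  obtain ⟨hpm, hcyc⟩ := exists_zsmul_eq_of_ne_zero X p S hS hm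
  obtain ⟨z₀, hz₀⟩ := hcyc (g • m)
  set c : Fin 2 → ZMod p := e (S.incl m) with hc
  have hc0 : c ≠ 0 := by
    intro h0
    apply hm
    apply S.incl_injective
    rw [map_zero]
    exact e.injective (by rw [map_zero, ← hc, h0])
  have hMc : M *ᵥ c = (z₀ : ZMod p) • c := by
    rw [hc, ← hρ g, ← S.incl_smul, hz₀, map_zsmul, map_zsmul, Int.cast_smul_eq_zsmul]
  -- a point off the line
  have hlt : Nat.card S.Sub < Nat.card (X.geomTorsion (p : ℤ)) := by
    have hE : Nat.card (X.geomTorsion (p : ℤ)) = p ^ 2 :=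
      WeierstrassCurve.card_torsionPoints_eq_sq_holds X (AlgebraicClosure K) (n := p)
        (by exact_mod_cast hpr.ne_zero)
    rw [hE, hS, pow_two]
    exact lt_mul_of_one_lt_right hpr.pos hpr.one_lt
  haveI : Finite S.Sub := Nat.finite_of_card_ne_zero (by rw [hS]; exact hpr.ne_zero)
  obtain ⟨P₀, hP₀⟩ : ∃ P₀ : X.geomTorsion (p : ℤ), P₀ ∉ S.toAddSubgroup := by
    by_contra hall
    push Not at hall
    have : Nat.card (X.geomTorsion (p : ℤ)) ≤ Nat.card S.Sub :=
      Nat.card_le_card_of_injective (fun P ↦ (⟨P, hall P⟩ : S.Sub)) (fun a b hab ↦ by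
        simpa using congrArg Subtype.val hab)
    exact absurd hlt (not_lt.mpr this)
  set u₀ : Fin 2 → ZMod p := e P₀ with hu₀
  -- `c ∧ u₀ ≠ 0`
  have hcu : c 0 * u₀ 1 - c 1 * u₀ 0 ≠ 0 := by
    intro h0
    obtain ⟨t, ht⟩ := exists_eq_smul_of_cross_eq_zero hc0 h0
    apply hP₀
    have : e P₀ = e ((t.val) • S.incl m) := by
      rw [← hu₀, ht, map_nsmul, ← hc, ← Nat.cast_smul_eq_nsmul (ZMod p) t.val c, ZMod.natCast_zmod_val]
    rw [e.injective this]
    exact S.toAddSubgroup.nsmul_mem (by rw [← S.range_incl]; exact ⟨m, rfl⟩) _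
  -- the quotient hypothesis at `P₀`: `M u₀ - ω u₀ ∈ line(c)`
  have hmem : g • P₀ - ω.val • P₀ ∈ S.toAddSubgroup := by
    rw [← S.ker_proj, AddMonoidHom.mem_ker, map_sub, map_nsmul, ← S.smul_proj, sub_eq_zero]
    exact hq (S.proj P₀)
  rw [← S.range_incl] at hmem
  obtain ⟨x, hx⟩ := hmem
  obtain ⟨z, hz⟩ := hcyc x
  have hMu : M *ᵥ u₀ - ω • u₀ = (z : ZMod p) • c := by
    have h1 : e (g • P₀ - ω.val • P₀) = e (S.incl x) := by rw [hx]
    rw [map_sub, hρ g, ← hu₀, map_nsmul, ← Nat.cast_smul_eq_nsmul (ZMod p) ω.val u₀,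
      ZMod.natCast_zmod_val, hz, map_zsmul, map_zsmul, ← hc] at h1
    rw [Int.cast_smul_eq_zsmul]
    exact h1
  -- cross identity: `(z₀ c) ∧ (ω u₀ + z c) = ω (c ∧ u₀)` ⟹ `z₀ ω = ω`
  have hcross := cross_mulVec M c u₀
  have hMu' : M *ᵥ u₀ = ω • u₀ + (z : ZMod p) • c := by rw [← hMu]; abel
  rw [hMc, hMu', hdet] at hcross
  simp only [Pi.add_apply, Pi.smul_apply, smul_eq_mul] at hcross
  have hz₀1 : (z₀ : ZMod p) = 1 := by
    have h' : ((z₀ : ZMod p) - 1) * (ω * (c 0 * u₀ 1 - c 1 * u₀ 0)) = 0 := by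
      linear_combination hcross
    rcases mul_eq_zero.mp h' with h1 | h1
    · exact sub_eq_zero.mp h1
    · exact absurd h1 (mul_ne_zero hω0 hcu)
  -- `z₀ ≡ 1 (mod p)` and `p • m = 0` ⟹ `z₀ • m = m`
  have hdvd : (p : ℤ) ∣ z₀ - 1 := by
    rw [← ZMod.intCast_zmod_eq_zero_iff_dvd, Int.cast_sub, Int.cast_one, hz₀1, sub_self]
  obtain ⟨j, hj⟩ := hdvd
  have hz₀eq : z₀ = 1 + p * j := by linear_combination hj
  rw [hz₀, hz₀eq, add_zsmul, one_zsmul, mul_comm, mul_zsmul, natCast_zsmul, hpm, zsmul_zero, add_zero]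

/-- **Hypothesis «`θ|_D ≠ ω`» for `M = E[p]/Φ`**: if `D` does NOT fix `Φ` pointwise (non-anomalous `φ`-clause),
then `D` does not act on `E[p]/Φ` through the mod-`p` cyclotomic character. [cite: CastellaGrossiLeeSkinner2022, §1.2 Prop. 14 (hypothesis θ|_{G_v̄} ≠ 1, ω) and §1.4] -/
theorem not_forall_smul_quot_eq_cyclotomic
    (S : StableSubgroup (absoluteGaloisGroup K) (X.geomTorsion (p : ℤ))) (hS : Nat.card S.Sub = p)
    (D : Subgroup (absoluteGaloisGroup K)) (hD : ¬ ∀ g ∈ D, ∀ m : S.Sub, g • m = m) :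
    ¬ ∀ g ∈ D, ∀ q : S.Quot,
      g • q = ((modNCyclotomicCharacter K p g : (ZMod p)ˣ) : ZMod p).val • q :=
  fun h ↦ hD fun g hg m ↦ smul_sub_eq_of_smul_quot_eq_cyclotomic X p S hS g (h g hg) m

end Line

end Summit.BirchSwinnertonDyer.BirchSwinnertonDyer.Theorems.CumulativeHeegnerInclusionAtThreeStubB1LineDeterminant

end
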